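import Summits.ValiantsHypothesis.ValiantsHypothesis.Theorems.LacunarySymmetroidMatrixDescartesCensusV20Check
import Summits.ValiantsHypothesis.ValiantsHypothesis.Theorems.LacunarySymmetroidMatrixDescartesCensusV20Box24Keys

/-!
# `MatrixDescartes` census — BOX24, `V = 20` layer: COVER CHECK A (`d₅ ≤ 20`) (every 2-Sidon support is a key or a mirror of one)

HONEST FRAMING.  Object-search cell `pub-symmetroid`; door-A item `DoorA26 = PosRootLawAt 2 6 19`
(stmt-ValiantsHypothesis-19979; OPEN, typed, never asserted).  Kernel check (`decide +kernel` of `V20.coverSlices`, `…CensusV20Check`): for the listed slices `(d₅, d₄-range)` of the box of sorted supports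
`0 = d₀ < ⋯ < d₅ ≤ 24`, every support whose 21 pair sums are distinct is a key of `…CensusV20Box24Keys` or the mirror of one.  Pure
enumeration bookkeeping; soundness `V20.box_of_plan` (`…CensusV20SoundTwenty`), use `…CensusV20Box24`.  Nothing here bears on `V = 19`, on `ζ_sym(2,6)` over all supports, on `DoorA26` itself, on `MatrixDescartes`
(stmt-ValiantsHypothesis-18050) or on `VP ≠ VNP`.

[folklore] Certificate-checker soundness / replay; elementary.
-/

-- the D-0017 layout repeats a namespace component (single-conjunct summit); the `dupNamespace` linter flags it; name mandated.
set_option linter.dupNamespace false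

namespace Summit.ValiantsHypothesis.ValiantsHypothesis.Theorems.LacunarySymmetroidMatrixDescartes.Census.V20

/-- Cover check of the slices `[(5, 4, 4), (6, 4, 5), (7, 4, 6), (8, 4, 7), (9, 4, 8), (10, 4, 9), (11, 4, 10), (12, 4, 11), (13, 4, 12), (14, 4, 13), (15, 4, 14), (16, 4, 15), (17, 4, 16), (18, 4, 17)]` against `box24Keys`. [folklore] -/
theorem cover24_a1 : coverSlices box24Keys [(5, 4, 4), (6, 4, 5), (7, 4, 6), (8, 4, 7), (9, 4, 8), (10, 4, 9), (11, 4, 10), (12, 4, 11), (13, 4, 12), (14, 4, 13), (15, 4, 14), (16, 4, 15), (17, 4, 16), (18, 4, 17)] = true := by decide +kernel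

/-- Cover check of the slices `[(19, 4, 18), (20, 4, 19)]` against `box24Keys`. [folklore] -/
theorem cover24_a2 : coverSlices box24Keys [(19, 4, 18), (20, 4, 19)] = true := by decide +kernel

end Summit.ValiantsHypothesis.ValiantsHypothesis.Theorems.LacunarySymmetroidMatrixDescartes.Census.V20
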